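/-
Copyright (c) 2026 the pub-hodgecm-mathlib formalisation cell (harness21).  Prover seat hodgecm-mathlib-LH4-p08 (g10), req620 Track A «(D-RAM) FOUR-FRAME» squad, helper lane
on h413 = stmt-HodgeConjecture-24833 (count-neutral).  β sub-dealer LH4-p05 (g8) LEDGER #12∕#13: ROW R6 «SPECIAL κ-CLASSES», tower 3 — B4 steps §1–§3 (R6-DERIVATION v2
0628fb8c §2∕§5): the κ-locus filter, the sign factorisation, and the per-representative value with the indicators left abstract.  2026-09-04.
-/
import Summits.HodgeConjecture.HodgeConjecture.Theorems.F0P3cDyRamLabelledOddG3OrbitDecomposition   -- ★ p861619 (LH4-p18 (g0)) (α)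
import Summits.HodgeConjecture.HodgeConjecture.Theorems.F0P3cDyRamLabelledOddKappaClassShellG3      -- ★ p861621 (LH4-p11 (g9)): κ-locus shell
import Summits.HodgeConjecture.HodgeConjecture.Theorems.F0P3cDyRamLabelledOddKappaClassValueG3      -- ★ p861783 (LH4-p11 (g9)): B1′
import Summits.HodgeConjecture.HodgeConjecture.Theorems.F0P3cDyRamKappaClassFootSums                -- ★ p861882 (this seat): (β3-foot)
import Summits.HodgeConjecture.HodgeConjecture.Theorems.F0P3cDyRamKappaClassLineTotal               -- ★ p861700 (this seat): bracket_eq_zero_above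
import Summits.HodgeConjecture.HodgeConjecture.Theorems.F0P3cDyRamStableCountTypeZero                -- ★ (LH4-p12): `v_diag_eq_one`, `diag_regular`
import Summits.HodgeConjecture.HodgeConjecture.Theorems.F0P3cDyRamDiagonalOrbitFibreCountHeads       -- ★: `finite_unitTorus_orbit_of_mem_normalisedStableLattices`
import HarnessLib

/-!
# Crux `H413`, line LH4 «(D-RAM) FOUR-FRAME» — (β) Stage B, β-BOARD row R6 (tower 3): THE PER-REPRESENTATIVE VALUE OF A κ-CLASS AT THE FOOT, SIGNS IN CLOSED FORM,
# INDICATORS ABSTRACT — `value_i(M(g)) = ½·ω(e_B)ω(1−κ′)·(ω(g)ω(1+g)ω(1+κ″∕g)·𝟙₀, ω(−1)ω(g)ω(1+κ″∕g)·𝟙₁, ω(−1)ω(1+κ″∕g)·𝟙₂)_i·w`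

Cell `hodgecm-mathlib` (D-0151), FLOOR 0, crux item H413 = `stmt-HodgeConjecture-24833`, route `HCCMUnconditional`; squad F0∕P3c∕LH4.  THEOREMS ONLY (no `def`, no instance, no
notation, no `sorry`, default heartbeats); ★-only imports; lane `--supports stmt-HodgeConjecture-24833 --as helper` (count-neutral); pays NO row, states NO law.

WHAT.  The tower-3 κ-CLASSES are the glued strata `(2ρ+2t, 2ρ+2t, 2ρ)` on the κ-LOCUS `2ρ + ℓ₀ = n₁ = n₂` below the read `2ρ + 2t + ℓ₀ < n₃` (LH4-cdis1 (g0) KAPPA-CLASS-RULE;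
this seat's R6-DERIVATION v1∕v2).  Towards F0P3a-p01 (g37)'s tower-3 dispatcher binder `hR6` (★ `…RestDispatchG3`), this file assembles the ★ inputs of the last hour into the
PER-REPRESENTATIVE value on LH4-p18 (g0)'s orbit representatives `M(g) = latt(1 0 0; (1+g)⁻¹ ϖ^{ρ+2t} 0; (1+g)⁻¹ −ϖ^{ρ+2t}g⁻¹ ϖ^{2ρ})` (★ p861619, `D(g) = π₀^{−(ρ+t)}(−(1+g)⁻¹, 1, g)`):
* §1 `finsum_stratum_G3_shell_labelledOdd_div_relIndex_eq_card_mul_sum_of_kappaLocus` — on the κ-locus below the read EVERY representative is `T`-stable (★ p861619 §2 at the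
  depths `2ρ+2t ≤ n₃`, `2ρ ≤ n₂`, `ρ ≤ n₁`; `n₂ ≤ n₁` by ★ p861621 `le_of_kappaLocus_G3`) and on the clean shell (★ p861621 `shell_of_mem_stratum_G3_kappaLocus`, LH4-p11 (g9)), so
  ★ p861619's orbit decomposition has the FULL index set `R`: `Σᶠ_{stratum ∧ shell} = |orbit| · Σ_{g ∈ R} value(M(g))` (the foot twin of ★ `…_of_read`).
* §2 `linearSum_latt_G3_rep_foot_eq`, `normSign_linearSum_mul_normSign_D_latt_G3_rep_foot` — the linear sum `S(g) = D₀(π₀^{ρ}e_B − π₀^{k₃}e_C) + D₁N(x)π₀^{ρ}e_B` of ★ p861570∕p861783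
  FACTORS: `S(g) = (−e_Bπ₀^{ρ})·(1−κ′)·(g + κ″) · N((ϖ^{ρ+t})⁻¹) · N((1+g)⁻¹)`, `κ′ = e_Cπ₀^{k₃}∕(e_Bπ₀^{ρ})` (`|κ′| = |ϖ|^{s_g} < 1`), `κ″ = −κ′∕(1−κ′)` — the twist of the κ-class
  sits on `g⁻¹` (★ p861882's inverted system) — whence the three sign products `ω(S)ω(D₂) = ω(−1)ω(e_B)ω(1−κ′)·ω(1+κ″∕g)`, `ω(S)ω(D₁) = … ·ω(g)ω(1+κ″∕g)`,
  `ω(S)ω(D₀) = ω(e_B)ω(1−κ′)·ω(g)ω(1+g)ω(1+κ″∕g)` (norms stripped by ★ `normSign_mul_norm`; ★ `normSign_mul_of_fixed`).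
* §3 `labelledOddCount_div_relIndex_latt_G3_rep_foot` — ★ p861783 (LH4-p11 (g9), the foot clone of LH7-p06's (β1)) at `M(g)` ∘ §2 ∘ ★ `stabiliserWeight_latt_G3_rep_eq`:
  `m^Λ_i(M(g))∕[𝒰:N′] = ω(e_B)ω(1−κ′) · (ω(g)ω(1+g)ω(1+κ″∕g)·𝟙₀(g), ω(−1)ω(g)ω(1+κ″∕g)·𝟙₁(g), ω(−1)ω(1+κ″∕g)·𝟙₂(g))_i ∕ 2 · w`, `w = ((q−1)q^{⌈(ρ+2t)∕2⌉−1}(q−1)q^{ρ−1})⁻¹`,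
  with the three INDICATORS `𝟙_j(g) = [∀ u ∈ S_F(M(g)), ω(u_j)·ω(u₀)·ω(1 + (u₁∕u₀ − 1)·c(g)) = 1]` LEFT ABSTRACT (their closed forms `𝟙₀ = 𝟙₁ = [2d−1 ≤ ρ]`, `𝟙₂ = […]` are the
  (β2-foot) brick, SPEC on the bus 16:20Z).
NEXT (B4 §4, this seat or its heir): `Σ_{g∈R}` of §3 by ★ p861882 (`Σ ω(1+κ″∕g)` = `#R ∕ −q^{⌈ρ∕2⌉−1} ∕ 0`, the twisted sums vanish), `#R = (q−1)q^{⌈ρ∕2⌉−1}` (★ `card_eq_card_of_repr` +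
★ `exists_fixed_class_representatives`), `|orbit|·w·q^{⌈ρ∕2⌉−1} = q^{2ρ+t−1}` ⇒ `κ₃ ρ (2t) = (0, 0, ω(−1)ω(e_B)∕2·q^{2ρ+t−1}·F(n₃ − ℓ₀ − 2ρ − 2t))` = ★ p861700's letter (LH4-p10 `harith`).
HONEST LABEL.  Count-neutral; the indicators are hypotheses-in-waiting, the κ-row∕hRest∕(β-BAL)∕(β)∕T₊ remain OPEN; `HC_CM` is proved only modulo the 7 printed citations (2 remaining
named inputs: hLiu418 = `stmt-HodgeConjecture-24832`, h413 = `stmt-HodgeConjecture-24833`) until rung 0 closes.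

## References
* [Kottwitz1986BaseChangeUnits] R. E. Kottwitz, *Base change for unit elements of Hecke algebras*, Compositio Math. 60 (1986), §1 pp. 240–241 (signed lattice counts by torus orbits; stabilisers).
* [LanglandsShelstad1987] R. P. Langlands, D. Shelstad, *On the definition of transfer factors*, Math. Ann. 278 (1987), §3 (κ-signs as characters).
* [Rogawski1990] J. D. Rogawski, *Automorphic Representations of Unitary Groups in Three Variables*, Ann. of Math. Stud. 123 (1990), §4.9 Prop. 4.9.1 (a)(b) p. 55, §4.10 p. 58.
* [Serre1979] J.-P. Serre, *Local Fields*, GTM 67 (1979), Ch. V §3 Cor. 3, Ch. XV §2 (norm residue symbol of a ramified quadratic extension).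
-/

set_option autoImplicit false

noncomputable section

namespace Summit.HodgeConjecture.HodgeConjecture.Cruxes.H413.F0P3cDyRamLabelledOddKappaClassRepFootG3

open Literature.NumberTheory.Automorphic Literature.NumberTheory.Automorphic.HermitianLattice
open Literature.NumberTheory.Automorphic.UnitaryLatticeTree Literature.NumberTheory.Automorphic.UnitaryThreeFourFrame
open Literature.NumberTheory.LocalFields Literature.NumberTheory.LocalFields.WildQuadraticDatum
open Summit.HodgeConjecture.HodgeConjecture.Cruxes.H413.F0P3cDyRamFourFramePieces
open Summit.HodgeConjecture.HodgeConjecture.Cruxes.H413.F0P3cDyRamFourFrameCensusDefs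
open Summit.HodgeConjecture.HodgeConjecture.Cruxes.H413.F0P3cDyRamStageOneBDefs (mcOfRecord)
open Summit.HodgeConjecture.HodgeConjecture.Cruxes.H413.F0P3cDyRamDiagonalTorusDefs
open Summit.HodgeConjecture.HodgeConjecture.Cruxes.H413.F0P3cDyRamDiagonalStrataDefs
open Summit.HodgeConjecture.HodgeConjecture.Cruxes.H413.F0P3cDyRamLabelledOddCountDefs
open Summit.HodgeConjecture.HodgeConjecture.Cruxes.H413.F0P3cDyRamLabelledOddG3OrbitDecomposition
open Summit.HodgeConjecture.HodgeConjecture.Cruxes.H413.F0P3cDyRamLabelledOddKappaClassShellG3 (le_of_kappaLocus_G3 shell_of_mem_stratum_G3_kappaLocus)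
open Summit.HodgeConjecture.HodgeConjecture.Cruxes.H413.F0P3cDyRamFixedCountDiagonalModel (normSign_mul_norm)
open Summit.HodgeConjecture.HodgeConjecture.Cruxes.H413.F0P3cDyRamDiagonalKappaSplitCountEval (normSign_mul_self)
open Summit.HodgeConjecture.HodgeConjecture.Cruxes.H413.F0P3cDyRamLabelledOddKappaClassValueG3 (labelledOddCount_div_relIndex_twoSlot_latt_G3_foot)
open Summit.HodgeConjecture.HodgeConjecture.Cruxes.H413.F0P3cDyRamStableCountTypeZero (v_diag_eq_one diag_regular)
open Summit.HodgeConjecture.HodgeConjecture.Cruxes.H413.F0P3cDyRamDiagonalOrbitFibreCountHeads (finite_unitTorus_orbit_of_mem_normalisedStableLattices)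
open scoped Valued WithZero Matrix MatrixGroups

variable {K : Type} [Field K] [Valued K ℤᵐ⁰] [Fintype 𝓀[K]] {σ : K →+* K} {ϖ : K} {d t₂ : ℕ} {α β : K} {N₀ n₁ n₂ n₃ : ℕ}

open Classical in
/-- **ON THE κ-LOCUS BELOW THE READ THE FILTER IS EVERYTHING**: element datum (`N₀ ≥ mcOfRecord d`), `T = diag(α, β, 1)`, κ-LOCUS `2ρ + ℓ₀ = n₂`, BELOW THE READ
`2ρ + 2t + ℓ₀ < n₃` (`s = 2t`): every `M(g)` is stable (★ §2 of p861619 at the depths `2ρ + 2t ≤ n₃`, `2ρ ≤ n₂`, `ρ ≤ n₁` — `n₂ ≤ n₁` by ★ `le_of_kappaLocus_G3`) and on the clean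
shell (★ p861621 `shell_of_mem_stratum_G3_kappaLocus`), so the sum is `|orbit| · Σ_{g ∈ R} m^Λ_i(M(g))∕[𝒰 : N(S̃(M(g)))]`. [cite: Kottwitz1986BaseChangeUnits, §1 pp. 240–241] [cite: LanglandsShelstad1987, §3] -/
theorem finsum_stratum_G3_shell_labelledOdd_div_relIndex_eq_card_mul_sum_of_kappaLocus (hD : IsRamifiedQuadraticDatum σ ϖ d t₂)
    (h2 : Valued.v (2 : K) < 1) (hE : IsElementDatum σ ϖ N₀ α β n₁ n₂ n₃) (hmc : mcOfRecord d ≤ N₀)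
    (T : GL (Fin 3) K) (hT : (T : Matrix (Fin 3) (Fin 3) K) = Matrix.diagonal ![α, β, 1])
    (ρ t : ℕ) (hρ : 1 ≤ ρ) (ht : 1 ≤ t) (hκ : 2 * ρ + d % 2 = n₂) (hlt : 2 * ρ + 2 * t + d % 2 < n₃)
    (R : Finset K) (hR1 : ∀ g ∈ R, σ g = g ∧ Valued.v g = Valued.v ϖ ^ (2 * t))
    (hR2 : ∀ f : K, σ f = f → Valued.v f = Valued.v ϖ ^ (2 * t) → ∃ g ∈ R, Valued.v (f - g) ≤ Valued.v ϖ ^ (ρ + 2 * t))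
    (hR3 : ∀ g ∈ R, ∀ g' ∈ R, Valued.v (g - g') ≤ Valued.v ϖ ^ (ρ + 2 * t) → g = g')
    (tv : ℕ) (i : Fin 3) {Λ : Submodule 𝒪[K] (Fin 3 → K) → (Fin 3 → K) → Prop} (hΛ : IsTorusEquivariantLabel σ Λ) :
    ∑ᶠ M ∈ {M : Submodule 𝒪[K] (Fin 3 → K) | M ∈ stratum σ ϖ T ![2 * ρ + 2 * t, 2 * ρ + 2 * t, 2 * ρ] ∧
        (LatticeInLevel ϖ (d % 2) (Matrix.diagonal ![α - 1, β - 1, 0]) M ∧ ¬ LatticeInLevel ϖ (d % 2 + 1) (Matrix.diagonal ![α - 1, β - 1, 0]) M ∧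
          LatticeInLevel ϖ (mcOfRecord d) (Matrix.diagonal ![(α - 1) * (α - 1), (β - 1) * (β - 1), 0]) M)},
      (labelledOddCount σ ϖ tv i Λ M : ℚ) / ((((unitStabilizer M).map (unitNormMap σ 3)).relIndex (fixedUnitTorus σ 3) : ℕ) : ℚ) =
    ((((Nat.card 𝓀[K] - 1) * Nat.card 𝓀[K] ^ (ρ + 2 * t - 1)) * ((Nat.card 𝓀[K] - 1) * Nat.card 𝓀[K] ^ (2 * ρ - 1)) : ℕ) : ℚ) *
      ∑ g ∈ R,
        (labelledOddCount σ ϖ tv i Λ (latt (!![1, 0, 0; (1 + g)⁻¹, ϖ ^ (ρ + 2 * t), 0; (1 + g)⁻¹, -(ϖ ^ (ρ + 2 * t) * g⁻¹), ϖ ^ (2 * ρ)] : Matrix (Fin 3) (Fin 3) K)) : ℚ) /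
          ((((unitStabilizer (latt (!![1, 0, 0; (1 + g)⁻¹, ϖ ^ (ρ + 2 * t), 0; (1 + g)⁻¹, -(ϖ ^ (ρ + 2 * t) * g⁻¹), ϖ ^ (2 * ρ)] : Matrix (Fin 3) (Fin 3) K))).map
              (unitNormMap σ 3)).relIndex (fixedUnitTorus σ 3) : ℕ) : ℚ) := by
  obtain ⟨-, hvσ, hϖ, -, -, -, -⟩ := id hD
  obtain ⟨h21, -⟩ := le_of_kappaLocus_G3 hD hE ρ (2 * t) hκ hlt
  have hρ₁ : 2 * ρ + 2 * t ≤ n₃ := by omega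
  have hρ₂ : 2 * ρ ≤ n₂ := by omega
  have hρ₃ : ρ ≤ n₁ := by omega
  rw [finsum_stratum_G3_shell_labelledOdd_div_relIndex_eq_card_mul_sum hD h2 T hT ρ t hρ ht R hR1 hR2 hR3 tv i hΛ]
  congr 1
  refine Finset.sum_congr (Finset.filter_true_of_mem fun g hg => ?_) fun _ _ => rfl
  have hst := mapGL_latt_G3_rep_of_depths hvσ hϖ hE T hT ht hρ₁ hρ₂ hρ₃ (hR1 g hg).2
  exact ⟨hst, shell_of_mem_stratum_G3_kappaLocus hD hE hmc T ρ (2 * t) hρ (by omega) hκ hlt _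
    (latt_G3_rep_mem_stratum_of_depths hD hE T hT hρ ht hρ₁ hρ₂ hρ₃ (hR1 g hg).1 (hR1 g hg).2)⟩

/-! ## §2  The signs of the per-representative value at the foot: `ω(S(g))·ω(D(g)_i)` -/

section Signs

variable [CompleteSpace K]

omit [Valued K ℤᵐ⁰] [Fintype 𝓀[K]] [CompleteSpace K] in
/-- **THE LINEAR SUM `S(g)` OF THE REPRESENTATIVE FACTORS THROUGH THE INVERTED TWIST**: with `P = (π₀^{ρ+t})⁻¹ = N((ϖ^{ρ+t})⁻¹)`, `x = (1+g)⁻¹`,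
`D(g) = P·(−(1+g)⁻¹, 1, g)`, `κ′ = e_Cπ₀^{k₃}∕(e_Bπ₀^{k₁})`, `κ″ = −κ′∕(1−κ′)`:
`S(g) = D₀(π₀^{k₁}e_B − π₀^{k₃}e_C) + D₁N(x)π₀^{k₁}e_B = ((−e_Bπ₀^{k₁})·((1−κ′)·(g + κ″))) · N((ϖ^{ρ+t})⁻¹) · N(x)` (pure algebra). [folklore] -/
theorem linearSum_latt_G3_rep_foot_eq {g eB eC : K} (hσg : σ g = g) (hg1 : (1 + g : K) ≠ 0) (heB0 : eB ≠ 0) (hϖ0 : ϖ ≠ 0) (hσϖ0 : σ ϖ ≠ 0)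
    (ρ t k₁ k₃ : ℕ) (hne : eB * (ϖ * σ ϖ) ^ k₁ - eC * (ϖ * σ ϖ) ^ k₃ ≠ 0) :
    -(((ϖ * σ ϖ) ^ (ρ + t))⁻¹ * (1 + g)⁻¹) * ((ϖ * σ ϖ) ^ k₁ * eB - (ϖ * σ ϖ) ^ k₃ * eC) +
        ((ϖ * σ ϖ) ^ (ρ + t))⁻¹ * (σ ((1 + g)⁻¹) * (1 + g)⁻¹) * ((ϖ * σ ϖ) ^ k₁ * eB) =
      ((-(eB * (ϖ * σ ϖ) ^ k₁)) * ((1 - eC * (ϖ * σ ϖ) ^ k₃ / (eB * (ϖ * σ ϖ) ^ k₁)) *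
          (g + -(eC * (ϖ * σ ϖ) ^ k₃ / (eB * (ϖ * σ ϖ) ^ k₁)) / (1 - eC * (ϖ * σ ϖ) ^ k₃ / (eB * (ϖ * σ ϖ) ^ k₁))))) *
        ((ϖ ^ (ρ + t))⁻¹ * σ ((ϖ ^ (ρ + t))⁻¹)) * ((1 + g)⁻¹ * σ ((1 + g)⁻¹)) := by
  have hσ1g : σ ((1 + g)⁻¹) = (1 + g)⁻¹ := by rw [map_inv₀, map_add, map_one, hσg]
  have hπk : ((ϖ * σ ϖ) ^ k₁ : K) ≠ 0 := pow_ne_zero _ (mul_ne_zero hϖ0 hσϖ0)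
  set κ' : K := eC * (ϖ * σ ϖ) ^ k₃ / (eB * (ϖ * σ ϖ) ^ k₁) with hκ'def
  have hκ1 : (1 : K) - κ' ≠ 0 := by
    rw [hκ'def, one_sub_div (mul_ne_zero heB0 hπk)]; exact div_ne_zero hne (mul_ne_zero heB0 hπk)
  have e1 : (1 - κ') * (g + -κ' / (1 - κ')) = (1 - κ') * g - κ' := by field_simp; ring
  have e2 : eB * (ϖ * σ ϖ) ^ k₁ * κ' = eC * (ϖ * σ ϖ) ^ k₃ := by rw [hκ'def]; field_simp
  rw [e1, hσ1g, show -(eB * (ϖ * σ ϖ) ^ k₁) * ((1 - κ') * g - κ') = -(eB * (ϖ * σ ϖ) ^ k₁) * g + (eB * (ϖ * σ ϖ) ^ k₁ * κ') * (1 + g) by ring, e2,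
    map_inv₀, map_pow, mul_pow, mul_pow]
  field_simp
  ring

/-- **THE THREE SIGN PRODUCTS `ω(S(g))·ω(D(g)_i)` AT THE FOOT** (`g`, `e_B`, `e_C` σ-fixed, `g ≠ 0`, `|g| < 1`, `|κ′| < 1` (below the read), `|κ″∕g| < 1`):
`ω(S)ω(D₂) = ω(−1)ω(e_B)ω(1−κ′)·ω(1 + κ″∕g)`, `ω(S)ω(D₁) = ω(−1)ω(e_B)ω(1−κ′)·ω(g)ω(1 + κ″∕g)`, `ω(S)ω(D₀) = ω(e_B)ω(1−κ′)·ω(g)ω(1+g)ω(1 + κ″∕g)`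
(the two norms are stripped, ★ `normSign_mul_norm`; `ω` is multiplicative on fixed non-zero scalars, ★ `normSign_mul_of_fixed`). [cite: Serre1979, Ch. V §3 Cor. 3] [cite: LanglandsShelstad1987, §3] -/
theorem normSign_linearSum_mul_normSign_D_latt_G3_rep_foot (hD : IsRamifiedQuadraticDatum σ ϖ d t₂)
    {g eB eC : K} (hσg : σ g = g) (hg0 : g ≠ 0) (hg : Valued.v g < 1) (hσeB : σ eB = eB) (heB0 : eB ≠ 0) (hσeC : σ eC = eC)
    (ρ t k₁ k₃ : ℕ) (hκ' : Valued.v (eC * (ϖ * σ ϖ) ^ k₃ / (eB * (ϖ * σ ϖ) ^ k₁)) < 1)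
    (hκ'' : Valued.v (-(eC * (ϖ * σ ϖ) ^ k₃ / (eB * (ϖ * σ ϖ) ^ k₁)) / (1 - eC * (ϖ * σ ϖ) ^ k₃ / (eB * (ϖ * σ ϖ) ^ k₁)) / g) < 1) :
    let S : K := -(((ϖ * σ ϖ) ^ (ρ + t))⁻¹ * (1 + g)⁻¹) * ((ϖ * σ ϖ) ^ k₁ * eB - (ϖ * σ ϖ) ^ k₃ * eC) +
        ((ϖ * σ ϖ) ^ (ρ + t))⁻¹ * (σ ((1 + g)⁻¹) * (1 + g)⁻¹) * ((ϖ * σ ϖ) ^ k₁ * eB)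
    let κ'' : K := -(eC * (ϖ * σ ϖ) ^ k₃ / (eB * (ϖ * σ ϖ) ^ k₁)) / (1 - eC * (ϖ * σ ϖ) ^ k₃ / (eB * (ϖ * σ ϖ) ^ k₁))
    (normSign σ S * normSign σ (((ϖ * σ ϖ) ^ (ρ + t))⁻¹ * g) =
        normSign σ (-1) * normSign σ eB * normSign σ (1 - eC * (ϖ * σ ϖ) ^ k₃ / (eB * (ϖ * σ ϖ) ^ k₁)) * normSign σ (1 + κ'' / g)) ∧
      (normSign σ S * normSign σ (((ϖ * σ ϖ) ^ (ρ + t))⁻¹) =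
        normSign σ (-1) * normSign σ eB * normSign σ (1 - eC * (ϖ * σ ϖ) ^ k₃ / (eB * (ϖ * σ ϖ) ^ k₁)) * (normSign σ g * normSign σ (1 + κ'' / g))) ∧
      (normSign σ S * normSign σ (-(((ϖ * σ ϖ) ^ (ρ + t))⁻¹ * (1 + g)⁻¹)) =
        normSign σ eB * normSign σ (1 - eC * (ϖ * σ ϖ) ^ k₃ / (eB * (ϖ * σ ϖ) ^ k₁)) * (normSign σ g * normSign σ (1 + g) * normSign σ (1 + κ'' / g))) := by
  intro S κ''
  obtain ⟨hσ, hvσ, hϖ, -, -, -, -⟩ := id hD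
  haveI : Finite 𝓀[K] := Finite.of_fintype _
  have hϖ0 : ϖ ≠ 0 := fun h0 => by rw [h0, map_zero] at hϖ; exact WithZero.coe_ne_zero hϖ.symm
  have hσϖ0 : σ ϖ ≠ 0 := (map_ne_zero σ).2 hϖ0
  have hπσ : σ (ϖ * σ ϖ) = ϖ * σ ϖ := by rw [map_mul, hσ, mul_comm]
  have hπkσ : ∀ k : ℕ, σ ((ϖ * σ ϖ) ^ k) = (ϖ * σ ϖ) ^ k := fun k => by rw [map_pow, hπσ]
  have hg1 : (1 + g : K) ≠ 0 := fun h => by have := Valued.v.map_one_add_of_lt hg; rw [h, map_zero] at this; exact zero_ne_one this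
  set κ' : K := eC * (ϖ * σ ϖ) ^ k₃ / (eB * (ϖ * σ ϖ) ^ k₁) with hκ'def
  have hσκ' : σ κ' = κ' := by rw [hκ'def, map_div₀, map_mul, map_mul, hσeC, hσeB, hπkσ, hπkσ]
  have hκ1 : (1 : K) - κ' ≠ 0 := fun h => by
    have := Valued.v.map_one_add_of_lt (x := -κ') (by rw [Valuation.map_neg]; exact hκ'); rw [← sub_eq_add_neg, h, map_zero] at this; exact zero_ne_one this
  have hne : eB * (ϖ * σ ϖ) ^ k₁ - eC * (ϖ * σ ϖ) ^ k₃ ≠ 0 := by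
    intro h
    apply hκ1
    have hπk : ((ϖ * σ ϖ) ^ k₁ : K) ≠ 0 := pow_ne_zero _ (mul_ne_zero hϖ0 hσϖ0)
    rw [hκ'def, one_sub_div (mul_ne_zero heB0 hπk), h, zero_div]
  have hσκ'' : σ κ'' = κ'' := by show σ (-κ' / (1 - κ')) = -κ' / (1 - κ'); rw [map_div₀, map_neg, map_sub, map_one, hσκ']
  have hu1 : (1 : K) + κ'' / g ≠ 0 := fun h => by have := Valued.v.map_one_add_of_lt hκ''; rw [h, map_zero] at this; exact zero_ne_one this
  have hσu : σ (1 + κ'' / g) = 1 + κ'' / g := by rw [map_add, map_one, map_div₀, hσκ'', hσg]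
  have hgκ : g + κ'' = g * (1 + κ'' / g) := by field_simp
  -- strip the two norms, then split the fixed factors
  have hS : S = ((-(eB * (ϖ * σ ϖ) ^ k₁)) * ((1 - κ') * (g + κ''))) * ((ϖ ^ (ρ + t))⁻¹ * σ ((ϖ ^ (ρ + t))⁻¹)) * ((1 + g)⁻¹ * σ ((1 + g)⁻¹)) :=
    linearSum_latt_G3_rep_foot_eq hσg hg1 heB0 hϖ0 hσϖ0 ρ t k₁ k₃ hne
  have hωS : normSign σ S = normSign σ (-1) * normSign σ eB * normSign σ (1 - κ') * (normSign σ g * normSign σ (1 + κ'' / g)) := by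
    rw [hS, normSign_mul_norm σ _ (inv_ne_zero hg1), normSign_mul_norm σ _ (inv_ne_zero (pow_ne_zero _ hϖ0)), hgκ,
      show -(eB * (ϖ * σ ϖ) ^ k₁) * ((1 - κ') * (g * (1 + κ'' / g))) = (((-1 : K) * eB) * ((1 - κ') * (g * (1 + κ'' / g)))) * (ϖ ^ k₁ * σ (ϖ ^ k₁)) by
        rw [map_pow, ← mul_pow]; ring,
      normSign_mul_norm σ _ (pow_ne_zero _ hϖ0),
      normSign_mul_of_fixed hD (by rw [map_mul, map_neg, map_one, hσeB]) (by rw [map_mul, map_sub, map_one, hσκ', map_mul, hσg, hσu])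
        (mul_ne_zero (neg_ne_zero.2 one_ne_zero) heB0) (mul_ne_zero hκ1 (mul_ne_zero hg0 hu1)),
      normSign_mul_of_fixed hD (by rw [map_neg, map_one]) hσeB (neg_ne_zero.2 one_ne_zero) heB0,
      normSign_mul_of_fixed hD (by rw [map_sub, map_one, hσκ']) (by rw [map_mul, hσg, hσu]) hκ1 (mul_ne_zero hg0 hu1),
      normSign_mul_of_fixed hD hσg hσu hg0 hu1]
    ring
  have hgg : normSign σ g * normSign σ g = 1 := normSign_mul_self σ g
  have h11 : normSign σ (-1 : K) * normSign σ (-1 : K) = 1 := normSign_mul_self σ (-1)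
  have hP : ((ϖ * σ ϖ) ^ (ρ + t))⁻¹ = (ϖ ^ (ρ + t))⁻¹ * σ ((ϖ ^ (ρ + t))⁻¹) := by rw [mul_pow, mul_inv, map_inv₀, map_pow]
  have hωP : normSign σ (((ϖ * σ ϖ) ^ (ρ + t))⁻¹) = 1 := normSign_of_isNorm σ ⟨(ϖ ^ (ρ + t))⁻¹, hP.symm⟩
  refine ⟨?_, ?_, ?_⟩
  · rw [hωS, hP, show (ϖ ^ (ρ + t))⁻¹ * σ ((ϖ ^ (ρ + t))⁻¹) * g = g * ((ϖ ^ (ρ + t))⁻¹ * σ ((ϖ ^ (ρ + t))⁻¹)) by ring,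
      normSign_mul_norm σ g (inv_ne_zero (pow_ne_zero _ hϖ0))]
    linear_combination (normSign σ (-1 : K) * normSign σ eB * normSign σ (1 - κ') * normSign σ (1 + κ'' / g)) * hgg
  · rw [hωS, hωP, mul_one]
  · rw [hωS, neg_mul_eq_neg_mul, normSign_mul_of_fixed hD (by rw [map_neg, map_inv₀, map_pow, hπσ]) (by rw [map_inv₀, map_add, map_one, hσg])
        (neg_ne_zero.2 (inv_ne_zero (pow_ne_zero _ (mul_ne_zero hϖ0 hσϖ0)))) (inv_ne_zero hg1),
      show -(((ϖ * σ ϖ) ^ (ρ + t))⁻¹) = (-1 : K) * ((ϖ * σ ϖ) ^ (ρ + t))⁻¹ by ring,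
      normSign_mul_of_fixed hD (by rw [map_neg, map_one]) (by rw [map_inv₀, map_pow, hπσ]) (neg_ne_zero.2 one_ne_zero) (inv_ne_zero (pow_ne_zero _ (mul_ne_zero hϖ0 hσϖ0))),
      hωP, mul_one, normSign_inv_of_map_eq σ (by rw [map_add, map_one, hσg]) hg1]
    linear_combination (normSign σ eB * normSign σ (1 - κ') * (normSign σ g * normSign σ (1 + g) * normSign σ (1 + κ'' / g))) * h11

end Signs

/-! ## §3  The per-representative value at the foot, indicators left abstract -/

section Rep

variable [CompleteSpace K]

open Classical in
/-- **THE PER-REPRESENTATIVE VALUE OF THE κ-CLASS AT THE FOOT** (`M(g)` of ★ p861619, `D(g) = π₀^{−(ρ+t)}(−(1+g)⁻¹, 1, g)`; κ-locus `2ρ + ℓ₀ = n₁ = n₂`, below the read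
`2ρ + 2t < 2k₃`, `2k₃ + ℓ₀ = n₃`; tokens `e_B` at `ρ`, `e_C` at `k₃`): ★ p861783 (LH4-p11) ∘ §2 —
`value_i(M(g)) = ½·(c_i(g)·𝟙_i(g))·w`, `(c₀, c₁, c₂) = ω(e_B)ω(1−κ′)·(ω(g)ω(1+g)ω(1+κ″∕g), ω(−1)ω(g)ω(1+κ″∕g), ω(−1)ω(1+κ″∕g))`. [cite: Kottwitz1986BaseChangeUnits, §1 pp. 240–241]
[cite: LanglandsShelstad1987, §3] [cite: Rogawski1990, §4.9 Prop. 4.9.1 (a)(b) p. 55] -/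
theorem labelledOddCount_div_relIndex_latt_G3_rep_foot (hD : IsRamifiedQuadraticDatum σ ϖ d t₂) (h2d : 2 ≤ d)
    (hE : IsElementDatum σ ϖ N₀ α β n₁ n₂ n₃) (hmc : mcOfRecord d ≤ N₀)
    (T : GL (Fin 3) K) (hT : (T : Matrix (Fin 3) (Fin 3) K) = Matrix.diagonal ![α, β, 1])
    {ρ t : ℕ} (hρ : 1 ≤ ρ) (ht : 1 ≤ t) (hκ : 2 * ρ + d % 2 = n₂) (h12 : n₁ = n₂)
    (k₃ : ℕ) (hlt : 2 * ρ + 2 * t < 2 * k₃) (hk₃ : 2 * k₃ + d % 2 = n₃)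
    {g : K} (hσg : σ g = g) (hg : Valued.v g = Valued.v ϖ ^ (2 * t))
    {eC : K} (hσeC : σ eC = eC) (heC1 : Valued.v eC = 1)
    (heC : Valued.v ((ϖ ^ (d % 2 + 2 * d - 1))⁻¹ * ((β - α) * ((ϖ * σ ϖ) ^ k₃)⁻¹ - eC * ((ϖ - σ ϖ) * ((ϖ * σ ϖ) ^ ((d - d % 2) / 2))⁻¹))) ≤ 1)
    {eB : K} (hσeB : σ eB = eB) (heB1 : Valued.v eB = 1)
    (heB : Valued.v ((ϖ ^ (d % 2 + 2 * d - 1))⁻¹ * ((β - 1) * ((ϖ * σ ϖ) ^ ρ)⁻¹ - eB * ((ϖ - σ ϖ) * ((ϖ * σ ϖ) ^ ((d - d % 2) / 2))⁻¹))) ≤ 1) (i : Fin 3) :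
    let M₀ : Submodule 𝒪[K] (Fin 3 → K) := latt (!![1, 0, 0; (1 + g)⁻¹, ϖ ^ (ρ + 2 * t), 0; (1 + g)⁻¹, -(ϖ ^ (ρ + 2 * t) * g⁻¹), ϖ ^ (2 * ρ)] : Matrix (Fin 3) (Fin 3) K)
    let c : K := ((ϖ * σ ϖ) ^ (ρ + t))⁻¹ * (σ ((1 + g)⁻¹) * (1 + g)⁻¹) * ((ϖ * σ ϖ) ^ ρ * eB) /
      (-(((ϖ * σ ϖ) ^ (ρ + t))⁻¹ * (1 + g)⁻¹) * ((ϖ * σ ϖ) ^ ρ * eB - (ϖ * σ ϖ) ^ k₃ * eC) +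
        ((ϖ * σ ϖ) ^ (ρ + t))⁻¹ * (σ ((1 + g)⁻¹) * (1 + g)⁻¹) * ((ϖ * σ ϖ) ^ ρ * eB))
    let κ'' : K := -(eC * (ϖ * σ ϖ) ^ k₃ / (eB * (ϖ * σ ϖ) ^ ρ)) / (1 - eC * (ϖ * σ ϖ) ^ k₃ / (eB * (ϖ * σ ϖ) ^ ρ))
    let ind : Fin 3 → ℤ := fun j => if ∀ u ∈ fixedUnitStabilizer σ M₀,
        normSign σ ((u j : Kˣ) : K) * (normSign σ ((u 0 : Kˣ) : K) * normSign σ (1 + (((u 1 : Kˣ) : K) / ((u 0 : Kˣ) : K) - 1) * c)) = 1 then 1 else 0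
    (labelledOddCount σ ϖ 0 i (valueClassLabel σ ϖ (α - 1) (β - 1) (mstarOfRecord d) d) M₀ : ℚ) /
        ((((unitStabilizer M₀).map (unitNormMap σ 3)).relIndex (fixedUnitTorus σ 3) : ℕ) : ℚ) =
      ((normSign σ eB * normSign σ (1 - eC * (ϖ * σ ϖ) ^ k₃ / (eB * (ϖ * σ ϖ) ^ ρ)) : ℤ) : ℚ) *
        ((![normSign σ g * normSign σ (1 + g) * normSign σ (1 + κ'' / g) * ind 0,
            normSign σ (-1) * (normSign σ g * normSign σ (1 + κ'' / g)) * ind 1,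
            normSign σ (-1) * normSign σ (1 + κ'' / g) * ind 2] : Fin 3 → ℤ) i : ℚ) / 2 *
        ((((Nat.card 𝓀[K] - 1) * Nat.card 𝓀[K] ^ ((ρ + 2 * t + 1) / 2 - 1)) * ((Nat.card 𝓀[K] - 1) * Nat.card 𝓀[K] ^ (ρ - 1)) : ℕ) : ℚ)⁻¹ := by
  intro M₀ c κ'' ind
  obtain ⟨hσ, hvσ, hϖ, -, -, -, -⟩ := id hD
  haveI : Finite 𝓀[K] := Finite.of_fintype _
  have hϖ0 : ϖ ≠ 0 := fun h0 => by rw [h0, map_zero] at hϖ; exact WithZero.coe_ne_zero hϖ.symm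
  have hϖ1 : Valued.v ϖ < 1 := by rw [hϖ, ← WithZero.exp_zero, WithZero.exp_lt_exp]; norm_num
  have hvϖ : 0 < Valued.v ϖ := (Valuation.pos_iff _).2 hϖ0
  have hσϖ0 : σ ϖ ≠ 0 := (map_ne_zero σ).2 hϖ0
  have hg0 : g ≠ 0 := fun h0 => by rw [h0, map_zero] at hg; exact (pow_ne_zero _ hvϖ.ne') hg.symm
  have hglt : Valued.v g < 1 := by rw [hg]; exact pow_lt_one₀ zero_le hϖ1 (by omega)
  have hg1 : (1 + g : K) ≠ 0 := fun h => by have := Valued.v.map_one_add_of_lt hglt; rw [h, map_zero] at this; exact zero_ne_one this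
  have heB0 : eB ≠ 0 := fun h => by rw [h, map_zero] at heB1; exact zero_ne_one heB1
  have hx : Valued.v ((1 + g)⁻¹ : K) = 1 := by rw [map_inv₀, Valued.v.map_one_add_of_lt hglt, inv_one]
  have hz : Valued.v (-(ϖ ^ (ρ + 2 * t) * g⁻¹) : K) = Valued.v (ϖ ^ ρ) := by
    rw [Valuation.map_neg, map_mul, map_inv₀, hg, map_pow, map_pow, pow_add, mul_assoc, mul_inv_cancel₀ (pow_ne_zero _ hvϖ.ne'), mul_one]
  -- depths and the inputs of ★ p861783 at the representative
  have hρ₁ : 2 * ρ + 2 * t ≤ n₃ := by omega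
  have hρ₂ : 2 * ρ ≤ n₂ := by omega
  have hρ₃ : ρ ≤ n₁ := by omega
  have hTM := mapGL_latt_G3_rep_of_depths hvσ hϖ hE T hT ht hρ₁ hρ₂ hρ₃ hg
  have hmem := latt_G3_rep_mem_stratum_of_depths hD hE T hT hρ ht hρ₁ hρ₂ hρ₃ hσg hg
  have hV := isVertexLattice_zero_latt_G3_rep hσ hvσ hϖ ρ t ht hσg hg
  have hPσ : σ (((ϖ * σ ϖ) ^ (ρ + t))⁻¹) = ((ϖ * σ ϖ) ^ (ρ + t))⁻¹ := by rw [map_inv₀, map_pow, map_mul, hσ, mul_comm]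
  have hP0 : (((ϖ * σ ϖ) ^ (ρ + t))⁻¹ : K) ≠ 0 := inv_ne_zero (pow_ne_zero _ (mul_ne_zero hϖ0 hσϖ0))
  have hD₁ : ∀ j, σ ((![-(((ϖ * σ ϖ) ^ (ρ + t))⁻¹ * (1 + g)⁻¹), ((ϖ * σ ϖ) ^ (ρ + t))⁻¹, ((ϖ * σ ϖ) ^ (ρ + t))⁻¹ * g] : Fin 3 → K) j) =
      (![-(((ϖ * σ ϖ) ^ (ρ + t))⁻¹ * (1 + g)⁻¹), ((ϖ * σ ϖ) ^ (ρ + t))⁻¹, ((ϖ * σ ϖ) ^ (ρ + t))⁻¹ * g] : Fin 3 → K) j ∧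
      (![-(((ϖ * σ ϖ) ^ (ρ + t))⁻¹ * (1 + g)⁻¹), ((ϖ * σ ϖ) ^ (ρ + t))⁻¹, ((ϖ * σ ϖ) ^ (ρ + t))⁻¹ * g] : Fin 3 → K) j ≠ 0 := by
    intro j; fin_cases j
    · exact ⟨by simp only [Fin.zero_eta, Matrix.cons_val_zero, map_neg, map_mul, hPσ, map_inv₀, map_add, map_one, hσg],
        by simp only [Fin.zero_eta, Matrix.cons_val_zero]; exact neg_ne_zero.2 (mul_ne_zero hP0 (inv_ne_zero hg1))⟩
    · exact ⟨by simp only [Fin.mk_one, Matrix.cons_val_one, Matrix.cons_val_zero, hPσ], by simp only [Fin.mk_one, Matrix.cons_val_one, Matrix.cons_val_zero]; exact hP0⟩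
    · exact ⟨by simp only [Fin.reduceFinMk, Matrix.cons_val_two, Matrix.tail_cons, Matrix.head_cons, map_mul, hPσ, hσg],
        by simp only [Fin.reduceFinMk, Matrix.cons_val_two, Matrix.tail_cons, Matrix.head_cons]; exact mul_ne_zero hP0 hg0⟩
  obtain ⟨hlev, hnlev, hsq⟩ := shell_of_mem_stratum_G3_kappaLocus hD hE hmc T ρ (2 * t) hρ (by omega) hκ (by omega) _ hmem
  have hfin := finite_unitTorus_orbit_of_mem_normalisedStableLattices hϖ (v_diag_eq_one hvσ hE) (diag_regular hE) T hT hmem.1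
  have hval := labelledOddCount_div_relIndex_twoSlot_latt_G3_foot hD h2d hE hmc T hT hρ (by omega : 1 ≤ 2 * t) hx hx hz k₃ hlt hk₃ ρ (by omega) (by omega)
    rfl hTM hD₁ hV hlev hnlev hsq hfin hσeC heC1 heC hσeB heB1 heB i
  rw [show mstarOfRecord d = d % 2 + 2 * d - 1 from rfl, hval, stabiliserWeight_latt_G3_rep_eq hD hρ ht hσg hg]
  -- the signs (§2): `|κ′| < 1` below the read, `|κ″∕g| < 1`
  have hvπ : ∀ k : ℕ, Valued.v ((ϖ * σ ϖ) ^ k) = Valued.v ϖ ^ (2 * k) := fun k => by rw [map_pow, map_mul, hvσ, ← pow_two, ← pow_mul, mul_comm]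
  have hκ'v : Valued.v (eC * (ϖ * σ ϖ) ^ k₃ / (eB * (ϖ * σ ϖ) ^ ρ)) = Valued.v ϖ ^ (2 * t) * Valued.v ϖ ^ (2 * (k₃ - ρ - t)) := by
    rw [map_div₀, map_mul, map_mul, heC1, heB1, one_mul, one_mul, hvπ, hvπ, div_eq_iff (pow_ne_zero _ hvϖ.ne'), ← pow_add, ← pow_add]; congr 1; omega
  have hκ'lt : Valued.v (eC * (ϖ * σ ϖ) ^ k₃ / (eB * (ϖ * σ ϖ) ^ ρ)) < 1 := by
    rw [hκ'v, ← pow_add]; exact pow_lt_one₀ zero_le hϖ1 (by omega)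
  have hκ''v : Valued.v κ'' = Valued.v ϖ ^ (2 * t) * Valued.v ϖ ^ (2 * (k₃ - ρ - t)) := by
    show Valued.v (-(eC * (ϖ * σ ϖ) ^ k₃ / (eB * (ϖ * σ ϖ) ^ ρ)) / (1 - eC * (ϖ * σ ϖ) ^ k₃ / (eB * (ϖ * σ ϖ) ^ ρ))) = _
    rw [map_div₀, Valuation.map_neg, hκ'v, sub_eq_add_neg, Valued.v.map_one_add_of_lt (by rw [Valuation.map_neg]; exact hκ'lt), div_one]
  have hκ''lt : Valued.v (κ'' / g) < 1 := by
    rw [map_div₀, hκ''v, hg, mul_div_cancel_left₀ _ (pow_ne_zero _ hvϖ.ne')]; exact pow_lt_one₀ zero_le hϖ1 (by omega)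
  obtain ⟨h2s, h1s, h0s⟩ := normSign_linearSum_mul_normSign_D_latt_G3_rep_foot hD hσg hg0 hglt hσeB heB0 hσeC ρ t ρ k₃ hκ'lt hκ''lt
  fin_cases i <;>
    simp only [Fin.zero_eta, Fin.mk_one, Fin.reduceFinMk, Fin.isValue, Matrix.cons_val_zero, Matrix.cons_val_one, Matrix.head_cons,
      Matrix.cons_val_two, Matrix.tail_cons, ← Int.cast_mul]
  · dsimp only [ind, c, M₀]; rw [h0s]; push_cast; ring
  · dsimp only [ind, c, M₀]; rw [h1s]; push_cast; ring
  · dsimp only [ind, c, M₀]; rw [h2s]; push_cast; ring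

end Rep

end Summit.HodgeConjecture.HodgeConjecture.Cruxes.H413.F0P3cDyRamLabelledOddKappaClassRepFootG3

end
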